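import Literature.Barriers.CriticalPhenomena.PlaquetteWalkHoleRootKillSignSchema
import HarnessLib

/-!
# Barrier catalogue (SAWScalingLimit): the EAST sign schemas with the dead-end column clause (eastern kill cells on
the east wall at any height), and the four such kills of the corner-kill table as closed theorems

Leaf of `PlaquetteWalkHoleRootKillSignSchema`. The east pair of the venture lane's LAW L — `K_S1 = (w.1 + 1, w.2 − 2)`
kills the under route's `w₁`-free class (`Im VF(2π/3) > 0`), `K_N2 = (w.1 + 1, w.2 + 2)` the over route's `w₂`-free
class (`Im VF(π/3) < 0`) — was typed (`PlaquetteWalkHoleRootEastQuadrant` §2/§5, `…KillSignSchema`) with a TWO-way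
column clause: below (above) the kill row, the column `w.1 + 1` has no western door (`(w.1, y)` or `(w.1 + 1, y)`
absent). The western twin (`PlaquetteWalkHoleRootStructuralKillQuadrant` §2, `ΩG.fc_ne_of_deadEnd`) has a THIRD
clause: the door may exist if the cell behind it is a DEAD END. This file adds the eastern dead-end clause —
`(w.1 + 2, y)`, `(w.1 + 1, y − 1)`, `(w.1 + 1, y + 1)` absent: the cell `(w.1 + 1, y)` has the western door only, so no
arc of a walk to the far cell lies in it (`ΩG.fc_ne_of_deadEndE`) — through the whole eastern chain:
`ΩG.cross_root_S_or_exists_nth_eq_rootS_E'`, `kindsIn_rootS_or_root_eq_of_AJ_ne_zero_under_quadrant'`,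
`ΩG.not_W1FreeOff_farW_of_wound_under_quadrant'` / `ΩG.under_w1_killed_of_killSE_quadrant'`, the row-mirror twins
`ΩG.not_W2FreeOff_farW_of_wound_over_quadrant'` / `ΩG.over_w2_killed_of_killNE_quadrant'`, and the sign schemas
`im_pos_two_pi_div_three_of_killSE_block42'`, `im_neg_pi_div_three_of_killNE_block42'` (reference position),
★ `im_vertexFunctional_printed_two_pi_div_three_pos_of_killSE_block'`, `…_pi_div_three_neg_of_killNE_block'` (every
position). Covered now: an eastern kill cell on the EAST WALL of a box one row off the corner (the corner below / above
it is a dead end) — the corner-kill table's frames `66b` (`(5,4)`), `66d` (`(5,1)`), `57a` (`(4,1)`, `(4,5)`),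
certified in §6 as the closed sign theorems `frame66b_KN2_sign`, `frame66d_KS1_sign`, `frame57a_KS1_sign`,
`frame57a_KN2_sign` on the exact domains `box ∖ {hole, K}` (with `PlaquetteWalkHoleRootLawLCertified`: 15 of the
table's 44 kills are closed theorems; the sibling leaf «LAW L TABLE» adds the 27 two-way / western instances).

Not in print; venture lane «pcv-sawmu», seat b-step0 gen 25.

References: A. Glazman, I. Manolescu, arXiv:1708.00395v3, §1, §4.2 and Lemma 2.1 [GlazmanManolescu2019]; A. Glazman,
Electron. Commun. Probab. 20 (2015) no. 86, Lemma 3.1 [Glazman2015WeightedSAW]; R. Courant, H. Robbins, *What is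
Mathematics?* (1941/1958), Ch. V Appendix §2 [CourantRobbins1958].
-/

noncomputable section

open Set Function Complex

namespace Literature.Probability.RandomPlanarGeometry.SAW.YangBaxter

open Real
open Literature.Barriers.CriticalPhenomena.PlaquetteWalk (mirrorRowFace mirrorRowFace_mirrorRowFace)

open private side_jOut from Literature.Probability.RandomPlanarGeometry.YangBaxterSAWExcursionJordan

namespace ΩG

variable {D : Set Face} {w : Face}

/-! ## §1 An eastern dead end carries no arc -/

/-- **A dead end (eastern form) carries no interior arc**: a cell whose eastern, southern and northern neighbours are
absent holds no arc of the walk at an index with a predecessor and a successor (both of its edges would have to be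
its western door). [cite: Glazman2015WeightedSAW, Lemma 3.1 (proof, pp. 6–7: the classes of walks through a rhombus)] -/
theorem fc_ne_of_deadEndE (c : Face) (hE : ((c.1 + 1, c.2) : Face) ∉ D) (hSo : ((c.1, c.2 - 1) : Face) ∉ D)
    (hNo : ((c.1, c.2 + 1) : Face) ∉ D) (ω : ΩG D (w.side .W) (farW w)) {i : ℕ} (hi0 : 0 < i)
    (hi : i + 1 < ω.2.arcs.length) : ω.2.fc i ≠ c := by
  intro e
  obtain ⟨hin, hout, hne⟩ := ω.2.side_sIn_nth (i := i) (by omega)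
  rw [e] at hin hout
  have hdin := ω.2.door_nth (j := i) hi0 (by omega)
  have hdout := ω.2.door_nth (j := i + 1) (by omega) hi
  rw [← hin] at hdin
  rw [← hout] at hdout
  obtain ⟨fW, fE, fS, fN⟩ := faces_side_cellQ c
  have key : ∀ s : Side, ((c.side s).faces.1 ∈ D ∧ (c.side s).faces.2 ∈ D) → s = .W := by
    intro s hs
    cases s
    · rfl
    · rw [fE] at hs; exact absurd hs.2 hE
    · rw [fS] at hs; exact absurd hs.1 hSo
    · rw [fN] at hs; exact absurd hs.2 hNo
  exact hne ((key _ hdin).trans (key _ hdout).symm)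

/-- A cell with a side on a side of the far cell lies west of the root plaquette's column.
[cite: GlazmanManolescu2019, §1 (the lattice of rhombi and its mid-edges)] -/
theorem fst_le_of_side_eq_farW_side {c : Face} {s t : Side} (h : c.side s = (farW w).side t) : c.1 ≤ w.1 - 1 := by
  obtain ⟨a, b⟩ := w
  obtain ⟨p, q⟩ := c
  cases s <;> cases t <;>
    simp only [farW, Face.side, MidEdge.vert.injEq, MidEdge.slant.injEq, reduceCtorEq] at h ⊢ <;> omega

/-! ## §2 The west crossing below the root plaquette, dead-end form -/

/-- ★★ **With `K_S1` absent and, below the kill row, no USABLE western door of the column east of the root plaquette —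
`(w.1, y)` or `(w.1 + 1, y)` absent, OR `(w.1 + 1, y)` a dead end (`(w.1 + 2, y)`, `(w.1 + 1, y ± 1)` absent) — the
west crossing is the `E` side of the cell below the root plaquette.** [cite: CourantRobbins1958, Ch. V Appendix §2 (the even–odd rule)]
[cite: Glazman2015WeightedSAW, Lemma 3.1 (proof, pp. 6–7: the classes of walks through a rhombus)] -/
theorem cross_root_S_or_exists_nth_eq_rootS_E' (hK : killSE w ∉ D)
    (hcol : ∀ y : ℤ, y ≤ w.2 - 3 → (w.1, y) ∉ D ∨ (w.1 + 1, y) ∉ D ∨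
      (((w.1 + 2, y) : Face) ∉ D ∧ ((w.1 + 1, y - 1) : Face) ∉ D ∧ ((w.1 + 1, y + 1) : Face) ∉ D))
    (ω : ΩG D (w.side .W) (farW w)) (hr : RootedFace D (w.side .W) (farW w)) (h : ω.IsB2a)
    (hA : ω.AJ hr h (toC (midPt (w.side .W))) ≠ 0) :
    (∃ i, ω.2.firstHitG ≤ i ∧ i < ω.2.arcs.length ∧ ω.2.nth (i + 1) = w.side .S) ∨
      ∃ i, ω.2.firstHitG ≤ i ∧ i < ω.2.arcs.length ∧ ω.2.nth (i + 1) = (rootS w).side .E := by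
  rcases ω.cross_root_S_or_exists_nth_isWestEdgeSE hr h hA with hc | ⟨k, hk1, hk2, he⟩
  · exact Or.inl hc
  right
  have hF := ω.fh_lt h
  cases hnth : ω.2.nth k with
  | slant x y => rw [hnth] at he; exact absurd he (by simp [IsWestEdgeSE])
  | vert x y =>
    rw [hnth] at he
    simp only [IsWestEdgeSE] at he
    obtain ⟨hx, hy⟩ := he
    subst hx
    have hdoor := ω.2.door_nth (j := k) (by omega) (by omega)
    rw [hnth] at hdoor
    simp only [MidEdge.faces, add_sub_cancel_right] at hdoor
    have hy1 : y = w.2 - 1 := by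
      rcases lt_or_eq_of_le hy with hlt | heq
      · exfalso
        rcases lt_or_eq_of_le (show y ≤ w.2 - 2 by omega) with hlt2 | heq2
        · rcases hcol y (by omega) with hc | hc | ⟨hcE, hcS, hcN⟩
          · exact hc hdoor.1
          · exact hc hdoor.2
          · -- the cell `c = (w.1 + 1, y)` behind the door is a dead end: no arc of the walk lies in it, yet one of
            -- the arcs `k - 1`, `k` does (they lie in the two faces of the crossed edge)
            set c : Face := (w.1 + 1, y) with hcdef
            have hce : ((c.1 + 1, c.2) : Face) ∉ D := by
              have e : ((c.1 + 1, c.2) : Face) = (w.1 + 2, y) := Prod.ext (by show w.1 + 1 + 1 = w.1 + 2; ring) rfl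
              rw [e]; exact hcE
            have hcs : ((c.1, c.2 - 1) : Face) ∉ D := hcS
            have hcn : ((c.1, c.2 + 1) : Face) ∉ D := hcN
            have hout := (ω.2.side_sIn_nth (i := k - 1) (by omega)).2.1
            have hin := (ω.2.side_sIn_nth (i := k) (by omega)).1
            rw [show k - 1 + 1 = k by omega, hnth] at hout
            rw [hnth] at hin
            have hf1 := (Face.exists_side_eq_iff _ _).1 ⟨_, hout⟩
            have hf2 := (Face.exists_side_eq_iff _ _).1 ⟨_, hin⟩
            simp only [MidEdge.faces, add_sub_cancel_right] at hf1 hf2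
            have hne : ω.2.fc (k - 1) ≠ ω.2.fc (k - 1 + 1) := YBWalk.fc_succ_ne (by omega)
            rw [show k - 1 + 1 = k by omega] at hne
            rcases hf1 with e1 | e1
            · rcases hf2 with e2 | e2
              · exact hne (e1.trans e2.symm)
              · -- arc `k` lies in `c`: it is not the last arc (the last arc leaves through a side of the far cell)
                have hkn : k + 1 < ω.2.arcs.length := by
                  rcases Nat.lt_or_ge (k + 1) ω.2.arcs.length with hl | hl
                  · exact hl
                  · exfalso
                    have hlast := (ω.2.side_sIn_nth (i := k) (by omega)).2.1
                    rw [show k + 1 = ω.2.arcs.length by omega, ω.2.nth_length, e2] at hlast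
                    have := fst_le_of_side_eq_farW_side hlast
                    simp only at this
                    omega
                exact ω.fc_ne_of_deadEndE c hce hcs hcn (i := k) (by omega) hkn e2
            · exact ω.fc_ne_of_deadEndE c hce hcs hcn (i := k - 1) (by omega) (by omega) e1
        · apply hK
          have e : killSE w = (w.1 + 1, y) := by rw [heq2]; rfl
          rw [e]; exact hdoor.2
      · exact heq
    refine ⟨k - 1, by omega, by omega, ?_⟩
    rw [show k - 1 + 1 = k by omega, hnth, hy1]
    obtain ⟨a, c⟩ := w; simp [rootS, Face.side]

/-! ## §3 The `K_S1` kill, dead-end form -/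

/-- ★★★ **THE DICHOTOMY FOR A WOUND UNDER-WALK, dead-end form.** [cite: GlazmanManolescu2019, §1, Fig. 1 (two arcs at the two θ-corners weigh w₁)]
[cite: CourantRobbins1958, Ch. V Appendix §2 (the even–odd rule)] [cite: Glazman2015WeightedSAW, Lemma 3.1 (proof, pp. 6–7)] -/
theorem kindsIn_rootS_or_root_eq_of_AJ_ne_zero_under_quadrant' (hh : holeFaceW w ∉ D) (hK : killSE w ∉ D)
    (hcol : ∀ y : ℤ, y ≤ w.2 - 3 → (w.1, y) ∉ D ∨ (w.1 + 1, y) ∉ D ∨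
      (((w.1 + 2, y) : Face) ∉ D ∧ ((w.1 + 1, y - 1) : Face) ∉ D ∧ ((w.1 + 1, y + 1) : Face) ∉ D))
    (ω : ΩG D (w.side .W) (farW w)) (hr : RootedFace D (w.side .W) (farW w)) (h : ω.IsB2a)
    (hS : ω.2.firstSideG = .S) (hA : ω.AJ hr h (toC (midPt (w.side .W))) ≠ 0) :
    ω.2.kindsIn (rootS w) = [.corner, .corner] ∨ ω.2.kindsIn w = [.corner, .corner] := by
  have hF := ω.fh_lt h
  rcases ω.cross_root_S_or_exists_nth_eq_rootS_E' hK hcol hr h hA with ⟨i, hFi, hin, e⟩ | ⟨i, hFi, hin, e⟩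
  · exact Or.inr (ω.kindsIn_root_eq_of_cross_root_S hh hr h ⟨i, hFi, hin, e⟩).2
  · left
    have hi1 : i + 1 < ω.2.arcs.length := by
      rcases Nat.lt_or_ge (i + 1) ω.2.arcs.length with hl | hl
      · exact hl
      · exfalso
        have e' : i + 1 = ω.2.arcs.length := by omega
        rw [e', ω.2.nth_length] at e
        exact farW_side_ne_rootS_side w ω.1 .E e
    have hFi' : ω.2.firstHitG < i := by
      rcases Nat.lt_or_ge ω.2.firstHitG i with hl | hl
      · exact hl
      · exfalso
        have eF : i = ω.2.firstHitG := by omega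
        have e1 : ω.2.nth (ω.2.firstHitG + 1) = (farW w).side (ω.z1 hr h) := (ω.2.exitSide_specG hr hF).1
        rw [eF, e1] at e
        exact farW_side_ne_rootS_side w _ .E e
    have hJ : ∃ j, j < ω.Mv ∧ (ω.jFace h j).side (ω.jOut hr h j) = (rootS w).side .E := by
      refine ⟨i - ω.2.firstHitG, by unfold ΩG.Mv; omega, ?_⟩
      rw [side_jOut (hr := hr) h (by unfold ΩG.Mv; omega),
        show ω.2.firstHitG + (i - ω.2.firstHitG) + 1 = i + 1 by omega, e]
    obtain ⟨i₀, hi₀1, hi₀F, hnth₀⟩ := exists_prefix_nth_eq_root_S_of_cross_rootS_E hh hr ω h hS hJ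
    exact kindsIn_rootS_eq_of_prefix_cross_of_cross_rootS_E ω hr h ⟨i₀, hi₀1, hi₀F, hnth₀⟩ ⟨i, hFi, hin, e⟩

/-- ★★★★ **THE STRUCTURAL `K_S1` KILL, dead-end form**: hole, kill cell, no usable western door of column `w.1 + 1`
below the kill row ⇒ every WOUND class-`B2a` UNDER-walk at the far cell is NOT `w₁`-free off the far cell.
[cite: GlazmanManolescu2019, §1, Fig. 1 and the remark after eq. (1) («w₁ = 0 at θ = 2π/3»)]
[cite: CourantRobbins1958, Ch. V Appendix §2 (the even–odd rule)] [cite: Glazman2015WeightedSAW, Lemma 3.1 (proof, pp. 6–7)] -/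
theorem not_W1FreeOff_farW_of_wound_under_quadrant' (hh : holeFaceW w ∉ D) (hK : killSE w ∉ D)
    (hcol : ∀ y : ℤ, y ≤ w.2 - 3 → (w.1, y) ∉ D ∨ (w.1 + 1, y) ∉ D ∨
      (((w.1 + 2, y) : Face) ∉ D ∧ ((w.1 + 1, y - 1) : Face) ∉ D ∧ ((w.1 + 1, y + 1) : Face) ∉ D))
    (ω : ΩG D (w.side .W) (farW w)) (hr : RootedFace D (w.side .W) (farW w)) (h : ω.IsB2a)
    (hS : ω.2.firstSideG = .S) {θ : ℝ}
    (hW : ω.WE (fun _ => θ) ≠ excursionWinding θ ω.2.firstSideG (ω.z1 hr h) ω.1) : ¬ω.2.W1FreeOff (farW w) := by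
  have key : ω.2.kindsIn (rootS w) = [.corner, .corner] ∨ ω.2.kindsIn w = [.corner, .corner] := by
    rcases ω.AJ_ne_zero_or_rev_of_wound hr h θ hW with hA | hA
    · exact kindsIn_rootS_or_root_eq_of_AJ_ne_zero_under_quadrant' hh hK hcol ω hr h hS hA
    · have h' := ω.rev_isB2a hr h
      have hS' : (ω.rev hr).2.firstSideG = .S := by rw [ω.rev_firstSide hr h]; exact hS
      have perm : ∀ {g : Face}, g ≠ farW w → (ω.rev hr).2.kindsIn g = [.corner, .corner] →
          ω.2.kindsIn g = [.corner, .corner] := by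
        intro g hg hk
        have hperm := ω.kindsIn_rev_perm hr h hg
        rw [hk] at hperm
        have hp : (ω.2.kindsIn g).Perm (List.replicate 2 .corner) := hperm.symm
        exact List.perm_replicate.1 hp
      rcases kindsIn_rootS_or_root_eq_of_AJ_ne_zero_under_quadrant' hh hK hcol (ω.rev hr) hr h' hS' hA with hk | hk
      · exact Or.inl (perm (rootS_ne_farW w) hk)
      · exact Or.inr (perm (root_ne_farW w) hk)
  intro hfree
  rcases key with hk | hk
  · have hmem : rootS w ∈ ω.2.facesVisited := by
      by_contra hn
      rw [YBWalk.kindsIn_eq_nil hn] at hk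
      exact List.cons_ne_nil _ _ hk.symm
    exact hfree _ hmem (rootS_ne_farW w) hk
  · have hmem : w ∈ ω.2.facesVisited := by
      by_contra hn
      rw [YBWalk.kindsIn_eq_nil hn] at hk
      exact List.cons_ne_nil _ _ hk.symm
    exact hfree _ hmem (root_ne_farW w) hk

/-- ★★★★ «Every wound under-walk is `w₁`-marked off the far cell», dead-end form — `K_S1` at ANY east-wall position.
[cite: GlazmanManolescu2019, §1, remark after eq. (1)] [cite: CourantRobbins1958, Ch. V Appendix §2 (the even–odd rule)] -/
theorem under_w1_killed_of_killSE_quadrant' (hh : holeFaceW w ∉ D) (hK : killSE w ∉ D)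
    (hcol : ∀ y : ℤ, y ≤ w.2 - 3 → (w.1, y) ∉ D ∨ (w.1 + 1, y) ∉ D ∨
      (((w.1 + 2, y) : Face) ∉ D ∧ ((w.1 + 1, y - 1) : Face) ∉ D ∧ ((w.1 + 1, y + 1) : Face) ∉ D))
    (hr : RootedFace D (w.side .W) (farW w)) (θ : ℝ) :
    ∀ (ω : ΩG D (w.side .W) (farW w)) (h : ω.IsB2a), ω.2.firstSideG = .S →
      ω.WE (fun _ => θ) ≠ excursionWinding θ ω.2.firstSideG (ω.z1 hr h) ω.1 → ¬ω.2.W1FreeOff (farW w) :=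
  fun ω h hS hW => not_W1FreeOff_farW_of_wound_under_quadrant' hh hK hcol ω hr h hS hW

/-! ## §4 The `K_N2` kill, dead-end form (row mirror) -/

/-- The reflection on the cells of columns `w.1`, `w.1 + 1`, `w.1 + 2`. [cite: GlazmanManolescu2019, §4.2 (lattice symmetries)] -/
private theorem mirrorRowFace_mkE (w : Face) (x y : ℤ) : mirrorRowFace w.2 ((x, y) : Face) = (x, 2 * w.2 - y) := by
  simp [mirrorRowFace]

/-- ★★★★ **THE STRUCTURAL `K_N2` KILL, dead-end form** (row-mirror twin): hole, `K_N2` absent, no usable western door of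
column `w.1 + 1` above the kill row ⇒ every wound class-`B2a` OVER-walk at the far cell is NOT `w₂`-free off the far
cell. [cite: GlazmanManolescu2019, §1, Fig. 1 and the paragraph of Fig. 2 («if θ = π/3, then w₂ = 0»)]
[cite: CourantRobbins1958, Ch. V Appendix §2 (the even–odd rule)] [cite: Glazman2015WeightedSAW, Lemma 3.1 (proof, pp. 6–7)] -/
theorem not_W2FreeOff_farW_of_wound_over_quadrant' (hh : holeFaceW w ∉ D) (hK : killNE w ∉ D)
    (hcol : ∀ y : ℤ, w.2 + 3 ≤ y → (w.1, y) ∉ D ∨ (w.1 + 1, y) ∉ D ∨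
      (((w.1 + 2, y) : Face) ∉ D ∧ ((w.1 + 1, y + 1) : Face) ∉ D ∧ ((w.1 + 1, y - 1) : Face) ∉ D))
    (ω : ΩG D (w.side .W) (farW w)) (hr : RootedFace D (w.side .W) (farW w)) (h : ω.IsB2a)
    (hN : ω.2.firstSideG = .N) {θ : ℝ}
    (hW : ω.WE (fun _ => θ) ≠ excursionWinding θ ω.2.firstSideG (ω.z1 hr h) ω.1) : ¬ω.2.W2FreeOff (farW w) := by
  have hr' := rootedFace_rowMirrorDom w hr
  have h' := ω.mirrorFar_isB2a hr h
  have hh' : holeFaceW w ∉ rowMirrorDom w D := by rwa [mem_rowMirrorDom, mirrorRowFace_holeFaceW]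
  have hK' : killSE w ∉ rowMirrorDom w D := by rwa [mem_rowMirrorDom, mirrorRowFace_killSE]
  have hcol' : ∀ y : ℤ, y ≤ w.2 - 3 → (w.1, y) ∉ rowMirrorDom w D ∨ (w.1 + 1, y) ∉ rowMirrorDom w D ∨
      (((w.1 + 2, y) : Face) ∉ rowMirrorDom w D ∧ ((w.1 + 1, y - 1) : Face) ∉ rowMirrorDom w D ∧
        ((w.1 + 1, y + 1) : Face) ∉ rowMirrorDom w D) := by
    intro y hy
    simp only [mem_rowMirrorDom, mirrorRowFace_mkE]
    rcases hcol (2 * w.2 - y) (by omega) with hc | hc | ⟨h1, h2, h3⟩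
    · exact Or.inl hc
    · exact Or.inr (Or.inl hc)
    · refine Or.inr (Or.inr ⟨h1, ?_, ?_⟩)
      · rw [show 2 * w.2 - (y - 1) = 2 * w.2 - y + 1 by ring]; exact h2
      · rw [show 2 * w.2 - (y + 1) = 2 * w.2 - y - 1 by ring]; exact h3
  have hS' : ω.mirrorFar.2.firstSideG = .S := by rw [ω.mirrorFar_firstSideG, hN]; rfl
  have hkill := not_W1FreeOff_farW_of_wound_under_quadrant' hh' hK' hcol' ω.mirrorFar hr' h' hS'
    (ω.mirrorFar_wound hr h hW)
  intro hfree
  apply hkill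
  intro g hg hgf hk
  have hk2 := ω.kindsIn_eq_coCorner_of_mirrorFar_corner hk
  have hmem : mirrorRowFace w.2 g ∈ ω.2.facesVisited := by
    by_contra hn
    rw [YBWalk.kindsIn_eq_nil hn] at hk2
    exact List.cons_ne_nil _ _ hk2.symm
  have hne : mirrorRowFace w.2 g ≠ farW w := by
    intro e
    apply hgf
    have e' := congrArg (mirrorRowFace w.2) e
    rw [mirrorRowFace_mirrorRowFace, mirrorRowFace_farW] at e'
    exact e'
  exact hfree _ hmem hne hk2

/-- ★★★★ «Every wound over-walk is `w₂`-marked off the far cell», dead-end form — `K_N2` at ANY east-wall position.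
[cite: GlazmanManolescu2019, §1 (the paragraph of Fig. 2)] [cite: CourantRobbins1958, Ch. V Appendix §2 (the even–odd rule)] -/
theorem over_w2_killed_of_killNE_quadrant' (hh : holeFaceW w ∉ D) (hK : killNE w ∉ D)
    (hcol : ∀ y : ℤ, w.2 + 3 ≤ y → (w.1, y) ∉ D ∨ (w.1 + 1, y) ∉ D ∨
      (((w.1 + 2, y) : Face) ∉ D ∧ ((w.1 + 1, y + 1) : Face) ∉ D ∧ ((w.1 + 1, y - 1) : Face) ∉ D))
    (hr : RootedFace D (w.side .W) (farW w)) (θ : ℝ) :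
    ∀ (ω : ΩG D (w.side .W) (farW w)) (h : ω.IsB2a), ω.2.firstSideG = .N →
      ω.WE (fun _ => θ) ≠ excursionWinding θ ω.2.firstSideG (ω.z1 hr h) ω.1 → ¬ω.2.W2FreeOff (farW w) :=
  fun ω h hN hW => not_W2FreeOff_farW_of_wound_over_quadrant' hh hK hcol ω hr h hN hW

end ΩG

end Literature.Probability.RandomPlanarGeometry.SAW.YangBaxter

namespace Literature.Barriers.CriticalPhenomena.PlaquetteWalk

open Literature.Probability.RandomPlanarGeometry.SAW.YangBaxter
open Real Complex

/-! ## §5 The eastern sign schemas, dead-end form -/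

section At42

variable {Dl : List Face}

/-- ★★★★ **`K_N2` ALONE ⇒ `Im VF(π/3) < 0`**, reference position, dead-end form. [cite: GlazmanManolescu2019, Lemma 2.1 (statement, "in the form given in [Gl]")]
[cite: GlazmanManolescu2019, §1 (the paragraph of Fig. 2)] -/
theorem im_neg_pi_div_three_of_killNE_block42' (hB : ∀ c ∈ eastBlock42, c ∈ Dl) (hh : holeFaceW w42 ∉ dom Dl)
    (hKN : killNE w42 ∉ dom Dl)
    (hcolN : ∀ y : ℤ, w42.2 + 3 ≤ y → (w42.1, y) ∉ dom Dl ∨ (w42.1 + 1, y) ∉ dom Dl ∨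
      (((w42.1 + 2, y) : Face) ∉ dom Dl ∧ ((w42.1 + 1, y + 1) : Face) ∉ dom Dl ∧ ((w42.1 + 1, y - 1) : Face) ∉ dom Dl)) :
    (vertexFunctional (printedWeights (π / 3)) tFiveEighths (ybCoeff (π / 3)) Dl (w42.side .W) (farW w42)).im < 0 := by
  have hf : farW w42 ∈ Dl := hB _ (by decide)
  have hr := rootedFace_of_farW_mem_of_hole hf hh
  exact im_vertexFunctional_printed_farCellW_pi_div_three_neg_of_over_killed Dl w42 hf hh hr
    (ΩG.over_w2_killed_of_killNE_quadrant' hh hKN hcolN hr _) (exists_under_witness_of_eastBlock42 hB hr _)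

/-- ★★★★ **`K_S1` ALONE ⇒ `Im VF(2π/3) > 0`**, reference position, dead-end form. [cite: GlazmanManolescu2019, Lemma 2.1 (statement, "in the form given in [Gl]")]
[cite: GlazmanManolescu2019, §1, remark after eq. (1)] -/
theorem im_pos_two_pi_div_three_of_killSE_block42' (hB : ∀ c ∈ eastBlock42, c ∈ Dl) (hh : holeFaceW w42 ∉ dom Dl)
    (hKS : killSE w42 ∉ dom Dl)
    (hcolS : ∀ y : ℤ, y ≤ w42.2 - 3 → (w42.1, y) ∉ dom Dl ∨ (w42.1 + 1, y) ∉ dom Dl ∨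
      (((w42.1 + 2, y) : Face) ∉ dom Dl ∧ ((w42.1 + 1, y - 1) : Face) ∉ dom Dl ∧ ((w42.1 + 1, y + 1) : Face) ∉ dom Dl)) :
    0 < (vertexFunctional (printedWeights (2 * π / 3)) tFiveEighths (ybCoeff (2 * π / 3)) Dl (w42.side .W)
      (farW w42)).im := by
  have hf : farW w42 ∈ Dl := hB _ (by decide)
  have hr := rootedFace_of_farW_mem_of_hole hf hh
  exact im_vertexFunctional_printed_farCellW_two_pi_div_three_pos_of_under_killed Dl w42 hf hh hr
    (ΩG.under_w1_killed_of_killSE_quadrant' hh hKS hcolS hr _) (exists_over_witness_of_eastBlock42 hB hr _)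

end At42

section Translate

variable {Dl : List Face} {w : Face}

/-- Transport of the eastern dead-end triple to the reference position. [cite: GlazmanManolescu2019, §4.2 (translation invariance)] -/
private theorem deadEndE_refShift {y : ℤ}
    (h : ((w.1 + 2, y + (w.2 - 2)) : Face) ∉ dom Dl ∧ ((w.1 + 1, y + (w.2 - 2) - 1) : Face) ∉ dom Dl ∧
      ((w.1 + 1, y + (w.2 - 2) + 1) : Face) ∉ dom Dl) :
    ((6, y) : Face) ∉ dom (Dl.map (Face.shiftBy (-refShift w))) ∧
      ((5, y - 1) : Face) ∉ dom (Dl.map (Face.shiftBy (-refShift w))) ∧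
        ((5, y + 1) : Face) ∉ dom (Dl.map (Face.shiftBy (-refShift w))) := by
  obtain ⟨h1, h2, h3⟩ := h
  refine ⟨not_mem_refShift 6 y ?_, not_mem_refShift 5 (y - 1) ?_, not_mem_refShift 5 (y + 1) ?_⟩
  · have e : ((6 + (w.1 - 4), y + (w.2 - 2)) : Face) = (w.1 + 2, y + (w.2 - 2)) := Prod.ext (by show 6 + (w.1 - 4) = w.1 + 2; ring) rfl
    rw [e]; exact h1
  · have e : ((5 + (w.1 - 4), y - 1 + (w.2 - 2)) : Face) = (w.1 + 1, y + (w.2 - 2) - 1) :=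
      Prod.ext (by show 5 + (w.1 - 4) = w.1 + 1; ring) (by show y - 1 + (w.2 - 2) = y + (w.2 - 2) - 1; ring)
    rw [e]; exact h2
  · have e : ((5 + (w.1 - 4), y + 1 + (w.2 - 2)) : Face) = (w.1 + 1, y + (w.2 - 2) + 1) :=
      Prod.ext (by show 5 + (w.1 - 4) = w.1 + 1; ring) (by show y + 1 + (w.2 - 2) = y + (w.2 - 2) + 1; ring)
    rw [e]; exact h3

/-- ★★★★★ **`K_N2` ALONE ⇒ `Im VF(π/3) < 0`, EVERY POSITION, dead-end form** — an eastern kill cell on the east wall of a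
box at ANY height (nothing is assumed east of column `w.1 + 2`'s absent cells). [cite: GlazmanManolescu2019, Lemma 2.1, §4.2]
[cite: GlazmanManolescu2019, §1 (the paragraph of Fig. 2)] [cite: CourantRobbins1958, Ch. V Appendix §2 (the even–odd rule)] -/
theorem im_vertexFunctional_printed_pi_div_three_neg_of_killNE_block' (hB : ∀ c ∈ eastBlock w, c ∈ Dl)
    (hh : holeFaceW w ∉ dom Dl) (hKN : killNE w ∉ dom Dl)
    (hcolN : ∀ y : ℤ, w.2 + 3 ≤ y → (w.1, y) ∉ dom Dl ∨ (w.1 + 1, y) ∉ dom Dl ∨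
      (((w.1 + 2, y) : Face) ∉ dom Dl ∧ ((w.1 + 1, y + 1) : Face) ∉ dom Dl ∧ ((w.1 + 1, y - 1) : Face) ∉ dom Dl)) :
    (vertexFunctional (printedWeights (π / 3)) tFiveEighths (ybCoeff (π / 3)) Dl (w.side .W) (farW w)).im < 0 := by
  rw [vertexFunctional_printed_eq_refShift Dl w]
  refine im_neg_pi_div_three_of_killNE_block42' (eastBlock42_mem_of_eastBlock hB) ?_ ?_ ?_
  · rw [mem_dom_map_shiftBy_neg, shiftBy_refShift_holeFaceW]; exact hh
  · refine not_mem_refShift 5 4 ?_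
    have e : ((5 + (w.1 - 4), 4 + (w.2 - 2)) : Face) = killNE w := Prod.ext (by simp [killNE]; ring) (by simp [killNE]; ring)
    rw [e]; exact hKN
  · intro y hy
    simp only [w42] at hy ⊢
    rw [show ((4 : ℤ) + 1, y) = ((5 : ℤ), y) by norm_num, show ((4 : ℤ) + 2, y) = ((6 : ℤ), y) by norm_num,
      show ((4 : ℤ) + 1, y + 1) = ((5 : ℤ), y + 1) by norm_num, show ((4 : ℤ) + 1, y - 1) = ((5 : ℤ), y - 1) by norm_num]
    rcases hcolN (y + (w.2 - 2)) (by omega) with h | h | ⟨h1, h2, h3⟩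
    · left; refine not_mem_refShift 4 y ?_
      have e : ((4 + (w.1 - 4), y + (w.2 - 2)) : Face) = (w.1, y + (w.2 - 2)) := Prod.ext (by show 4 + (w.1 - 4) = w.1; ring) rfl
      rw [e]; exact h
    · right; left; refine not_mem_refShift 5 y ?_
      have e : ((5 + (w.1 - 4), y + (w.2 - 2)) : Face) = (w.1 + 1, y + (w.2 - 2)) := Prod.ext (by show 5 + (w.1 - 4) = w.1 + 1; ring) rfl
      rw [e]; exact h
    · right; right
      obtain ⟨e1, e2, e3⟩ := deadEndE_refShift (Dl := Dl) (w := w) (y := y) ⟨h1, h3, h2⟩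
      exact ⟨e1, e3, e2⟩

/-- ★★★★★ **`K_S1` ALONE ⇒ `Im VF(2π/3) > 0`, EVERY POSITION, dead-end form.** [cite: GlazmanManolescu2019, Lemma 2.1, §4.2]
[cite: GlazmanManolescu2019, §1, remark after eq. (1)] [cite: CourantRobbins1958, Ch. V Appendix §2 (the even–odd rule)] -/
theorem im_vertexFunctional_printed_two_pi_div_three_pos_of_killSE_block' (hB : ∀ c ∈ eastBlock w, c ∈ Dl)
    (hh : holeFaceW w ∉ dom Dl) (hKS : killSE w ∉ dom Dl)
    (hcolS : ∀ y : ℤ, y ≤ w.2 - 3 → (w.1, y) ∉ dom Dl ∨ (w.1 + 1, y) ∉ dom Dl ∨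
      (((w.1 + 2, y) : Face) ∉ dom Dl ∧ ((w.1 + 1, y - 1) : Face) ∉ dom Dl ∧ ((w.1 + 1, y + 1) : Face) ∉ dom Dl)) :
    0 < (vertexFunctional (printedWeights (2 * π / 3)) tFiveEighths (ybCoeff (2 * π / 3)) Dl (w.side .W) (farW w)).im := by
  rw [vertexFunctional_printed_eq_refShift Dl w]
  refine im_pos_two_pi_div_three_of_killSE_block42' (eastBlock42_mem_of_eastBlock hB) ?_ ?_ ?_
  · rw [mem_dom_map_shiftBy_neg, shiftBy_refShift_holeFaceW]; exact hh
  · refine not_mem_refShift 5 0 ?_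
    have e : ((5 + (w.1 - 4), 0 + (w.2 - 2)) : Face) = killSE w := Prod.ext (by simp [killSE]; ring) (by simp [killSE])
    rw [e]; exact hKS
  · intro y hy
    simp only [w42] at hy ⊢
    rw [show ((4 : ℤ) + 1, y) = ((5 : ℤ), y) by norm_num, show ((4 : ℤ) + 2, y) = ((6 : ℤ), y) by norm_num,
      show ((4 : ℤ) + 1, y - 1) = ((5 : ℤ), y - 1) by norm_num, show ((4 : ℤ) + 1, y + 1) = ((5 : ℤ), y + 1) by norm_num]
    rcases hcolS (y + (w.2 - 2)) (by omega) with h | h | h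
    · left; refine not_mem_refShift 4 y ?_
      have e : ((4 + (w.1 - 4), y + (w.2 - 2)) : Face) = (w.1, y + (w.2 - 2)) := Prod.ext (by show 4 + (w.1 - 4) = w.1; ring) rfl
      rw [e]; exact h
    · right; left; refine not_mem_refShift 5 y ?_
      have e : ((5 + (w.1 - 4), y + (w.2 - 2)) : Face) = (w.1 + 1, y + (w.2 - 2)) := Prod.ext (by show 5 + (w.1 - 4) = w.1 + 1; ring) rfl
      rw [e]; exact h
    · right; right; exact deadEndE_refShift h

end Translate

/-! ## §6 The four east-wall kills one row off a corner in the corner-kill table, as closed sign theorems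

Frames `66b = 6×6 ∖ (3,2)` (cell `(5,4)`: the corner `(5,5)` above it is a dead end), `66d = 6×6 ∖ (3,3)` (cell `(5,1)`:
dead end `(5,0)`), `57a = 5×7 ∖ (2,3)` (cells `(4,1)`, `(4,5)`: dead ends `(4,0)`, `(4,6)`) of the venture lane's
pre-registered LAW L (`FINDING-YB-KILL-FORCED-ZEROS.md` §5): each predicted (and observed) kill is the schema above
instantiated on the face list `box ∖ {hole, K}` — block membership, absences and the dead-end triple by `decide`. -/

/-- LAW L frame `66b` = `6×6 ∖ (3, 2)` with the kill cell `(5, 4)` removed alone. [cite: GlazmanManolescu2019, §2.1 (finite domains of faces)] -/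
def frame66b_KN2 : List Face := [(0,0),(0,1),(0,2),(0,3),(0,4),(0,5),(1,0),(1,1),(1,2),(1,3),(1,4),(1,5),(2,0),(2,1),(2,2),(2,3),(2,4),(2,5),(3,0),(3,1),(3,3),(3,4),(3,5),(4,0),(4,1),(4,2),(4,3),(4,4),(4,5),(5,0),(5,1),(5,2),(5,3),(5,5)]

/-- ★ LAW L, frame `66b` (`6×6 ∖ (3, 2)`), cell `(5, 4)` = `K_N2` (over route, `w₂`): the predicted kill as a closed sign theorem. [cite: GlazmanManolescu2019, Lemma 2.1 (statement, "in the form given in [Gl]")] -/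
theorem frame66b_KN2_sign : (vertexFunctional (printedWeights (π / 3)) tFiveEighths (ybCoeff (π / 3)) frame66b_KN2 (Face.side (4, 2) .W) (farW (4, 2))).im < 0 :=
  im_vertexFunctional_printed_pi_div_three_neg_of_killNE_block' (Dl := frame66b_KN2) (w := (4, 2)) (by decide)
    (show holeFaceW (4, 2) ∉ frame66b_KN2 by decide) (show killNE (4, 2) ∉ frame66b_KN2 by decide)
    (fun y hy => by
      rcases (show y = 5 ∨ 6 ≤ y by simp only at hy; omega) with rfl | hy'
      · exact Or.inr (Or.inr ⟨show ((4 : ℤ) + 2, (5 : ℤ)) ∉ frame66b_KN2 by decide,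
          show ((4 : ℤ) + 1, (5 : ℤ) + 1) ∉ frame66b_KN2 by decide, show ((4 : ℤ) + 1, (5 : ℤ) - 1) ∉ frame66b_KN2 by decide⟩)
      · exact Or.inl (show (((4 : ℤ)), y) ∉ frame66b_KN2 by
          simp only [frame66b_KN2, List.mem_cons, Prod.mk.injEq, List.not_mem_nil, or_false, not_or, not_and]
          omega))

/-- LAW L frame `66d` = `6×6 ∖ (3, 3)` with the kill cell `(5, 1)` removed alone. [cite: GlazmanManolescu2019, §2.1 (finite domains of faces)] -/
def frame66d_KS1 : List Face := [(0,0),(0,1),(0,2),(0,3),(0,4),(0,5),(1,0),(1,1),(1,2),(1,3),(1,4),(1,5),(2,0),(2,1),(2,2),(2,3),(2,4),(2,5),(3,0),(3,1),(3,2),(3,4),(3,5),(4,0),(4,1),(4,2),(4,3),(4,4),(4,5),(5,0),(5,2),(5,3),(5,4),(5,5)]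

/-- ★ LAW L, frame `66d` (`6×6 ∖ (3, 3)`), cell `(5, 1)` = `K_S1` (under route, `w₁`): the predicted kill as a closed sign theorem. [cite: GlazmanManolescu2019, Lemma 2.1 (statement, "in the form given in [Gl]")] -/
theorem frame66d_KS1_sign : 0 < (vertexFunctional (printedWeights (2 * π / 3)) tFiveEighths (ybCoeff (2 * π / 3)) frame66d_KS1 (Face.side (4, 3) .W) (farW (4, 3))).im :=
  im_vertexFunctional_printed_two_pi_div_three_pos_of_killSE_block' (Dl := frame66d_KS1) (w := (4, 3)) (by decide)
    (show holeFaceW (4, 3) ∉ frame66d_KS1 by decide) (show killSE (4, 3) ∉ frame66d_KS1 by decide)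
    (fun y hy => by
      rcases (show y = 0 ∨ y ≤ -1 by simp only at hy; omega) with rfl | hy'
      · exact Or.inr (Or.inr ⟨show ((4 : ℤ) + 2, (0 : ℤ)) ∉ frame66d_KS1 by decide,
          show ((4 : ℤ) + 1, (0 : ℤ) - 1) ∉ frame66d_KS1 by decide, show ((4 : ℤ) + 1, (0 : ℤ) + 1) ∉ frame66d_KS1 by decide⟩)
      · exact Or.inl (show (((4 : ℤ)), y) ∉ frame66d_KS1 by
          simp only [frame66d_KS1, List.mem_cons, Prod.mk.injEq, List.not_mem_nil, or_false, not_or, not_and]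
          omega))

/-- LAW L frame `57a` = `5×7 ∖ (2, 3)` with the kill cell `(4, 1)` removed alone. [cite: GlazmanManolescu2019, §2.1 (finite domains of faces)] -/
def frame57a_KS1 : List Face := [(0,0),(0,1),(0,2),(0,3),(0,4),(0,5),(0,6),(1,0),(1,1),(1,2),(1,3),(1,4),(1,5),(1,6),(2,0),(2,1),(2,2),(2,4),(2,5),(2,6),(3,0),(3,1),(3,2),(3,3),(3,4),(3,5),(3,6),(4,0),(4,2),(4,3),(4,4),(4,5),(4,6)]

/-- ★ LAW L, frame `57a` (`5×7 ∖ (2, 3)`), cell `(4, 1)` = `K_S1` (under route, `w₁`): the predicted kill as a closed sign theorem. [cite: GlazmanManolescu2019, Lemma 2.1 (statement, "in the form given in [Gl]")] -/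
theorem frame57a_KS1_sign : 0 < (vertexFunctional (printedWeights (2 * π / 3)) tFiveEighths (ybCoeff (2 * π / 3)) frame57a_KS1 (Face.side (3, 3) .W) (farW (3, 3))).im :=
  im_vertexFunctional_printed_two_pi_div_three_pos_of_killSE_block' (Dl := frame57a_KS1) (w := (3, 3)) (by decide)
    (show holeFaceW (3, 3) ∉ frame57a_KS1 by decide) (show killSE (3, 3) ∉ frame57a_KS1 by decide)
    (fun y hy => by
      rcases (show y = 0 ∨ y ≤ -1 by simp only at hy; omega) with rfl | hy'
      · exact Or.inr (Or.inr ⟨show ((3 : ℤ) + 2, (0 : ℤ)) ∉ frame57a_KS1 by decide,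
          show ((3 : ℤ) + 1, (0 : ℤ) - 1) ∉ frame57a_KS1 by decide, show ((3 : ℤ) + 1, (0 : ℤ) + 1) ∉ frame57a_KS1 by decide⟩)
      · exact Or.inl (show (((3 : ℤ)), y) ∉ frame57a_KS1 by
          simp only [frame57a_KS1, List.mem_cons, Prod.mk.injEq, List.not_mem_nil, or_false, not_or, not_and]
          omega))

/-- LAW L frame `57a` = `5×7 ∖ (2, 3)` with the kill cell `(4, 5)` removed alone. [cite: GlazmanManolescu2019, §2.1 (finite domains of faces)] -/
def frame57a_KN2 : List Face := [(0,0),(0,1),(0,2),(0,3),(0,4),(0,5),(0,6),(1,0),(1,1),(1,2),(1,3),(1,4),(1,5),(1,6),(2,0),(2,1),(2,2),(2,4),(2,5),(2,6),(3,0),(3,1),(3,2),(3,3),(3,4),(3,5),(3,6),(4,0),(4,1),(4,2),(4,3),(4,4),(4,6)]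

/-- ★ LAW L, frame `57a` (`5×7 ∖ (2, 3)`), cell `(4, 5)` = `K_N2` (over route, `w₂`): the predicted kill as a closed sign theorem. [cite: GlazmanManolescu2019, Lemma 2.1 (statement, "in the form given in [Gl]")] -/
theorem frame57a_KN2_sign : (vertexFunctional (printedWeights (π / 3)) tFiveEighths (ybCoeff (π / 3)) frame57a_KN2 (Face.side (3, 3) .W) (farW (3, 3))).im < 0 :=
  im_vertexFunctional_printed_pi_div_three_neg_of_killNE_block' (Dl := frame57a_KN2) (w := (3, 3)) (by decide)
    (show holeFaceW (3, 3) ∉ frame57a_KN2 by decide) (show killNE (3, 3) ∉ frame57a_KN2 by decide)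
    (fun y hy => by
      rcases (show y = 6 ∨ 7 ≤ y by simp only at hy; omega) with rfl | hy'
      · exact Or.inr (Or.inr ⟨show ((3 : ℤ) + 2, (6 : ℤ)) ∉ frame57a_KN2 by decide,
          show ((3 : ℤ) + 1, (6 : ℤ) + 1) ∉ frame57a_KN2 by decide, show ((3 : ℤ) + 1, (6 : ℤ) - 1) ∉ frame57a_KN2 by decide⟩)
      · exact Or.inl (show (((3 : ℤ)), y) ∉ frame57a_KN2 by
          simp only [frame57a_KN2, List.mem_cons, Prod.mk.injEq, List.not_mem_nil, or_false, not_or, not_and]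
          omega))


end Literature.Barriers.CriticalPhenomena.PlaquetteWalk
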